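/-
Copyright: the b2b-balaban T⁴-continuum CRUX team, row NE7b OWNER lineage `t4-ne7b-p1` (gen 137). Project licence.
-/
import Summits.QuantumFields.BalabanUV.T4Continuum.Spine.NE7b.SupBlockNextHessianMatrix
import Summits.QuantumFields.BalabanUV.T4Continuum.Spine.NE7b.SupResidualSecondOrderClass

/-!
# THE RESIDUAL OF A BLOCK INPUT IS GLOBALLY REGULATED BY ITS SECOND-ORDER CLASS, AND IS AGAIN IN THAT CLASS — (391)∕(394)'s BLOCK TWINS.
# For a `C²` block potential `U` with the block letters on `Y`, the two-point upper letter of constant `Λ` (on `Y`) and the secant lower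
# letter of constant `λ` (`2λ ≤ m`, over `N(0,M⁻¹)`): after extracting the constant, `⟨b_D,ζ⟩` and `½ζᵀK_Dζ` ((404)) from `W = −log Z` at the
# background `ψ₀`, the residual `r(ζ) = log Z(ψ₀+ζ) − log Z(ψ₀) + ⟨b_D,ζ⟩ + ½ζᵀK_Dζ` obeys, for EVERY `ζ` (no ball, no smallness of the
# field),
#   `|r(ζ)| ≤ λ·Σ_iζ_i² + ½Λ·Σ_Yζ²`,   hence   `e^{∓(λΣ_iζ_i² + ½ΛΣ_Yζ²)}` brackets `e^{r(ζ)}`,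
# by the two GLOBAL second-order letters of `W` ((400) upper on `Y`, (401) lower) and the two Hessian letters ((403)∕(404)); and the next
# single-block potential `w⁺ := −r` satisfies for ALL `ζ, ζ′` the two-sided second-order letters
#   `−(λΣ_i(ζ′−ζ)_i² + ½ΛΣ_Y(ζ′−ζ)²) ≤ w⁺(ζ′) − w⁺(ζ) − Dw⁺(ζ)(ζ′−ζ) ≤ ½ΛΣ_Y(ζ′−ζ)² + λΣ_i(ζ′−ζ)_i²`
# — THE CLASS REPRODUCES FOR BLOCK-LOCAL INPUTS with the lower letter on ALL sites as (401) types it (the `Y`-forms follow for `Y`-LOCAL `U`,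
# the successor's locality file) and constants that ADD before rescaling (row NE7b, node U5c; (399)–(404)∕(391)∕(394) BY NAME; [folklore])

Cell `pub-balaban`, sub-cell `t4`, spine estimate NE7b (`T4WeightBudget.RelWeightBound`; the cell's OWN estimate — NOT PRINTED in
[Bałaban 1983–89], NOT PROVED).  Crux-route work under `Spine/NE7b/` by the row OWNER (`t4-ne7b-p1` gen 137, file (409)) under FREEZE
(0)'s crux-prover clause, on gen 136's SCOPING-d8 DECISION (d8′) («the literal re-run of (386)∕(389)∕(391)∕(394) with `U` for `Σw`»);
NOTHING of Bałaban's is named as a Lean object, valued or asserted; no `T4Continuum/Support` leaf typed; no `def`, no notation (`b_D`,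
`K_D`, `r`, `w⁺` WRITTEN OUT); zero `sorry`.  Imports (BY NAME): the OWNER's (404) `…SupBlockNextHessianMatrix` and through it (403)
(`hessian_block_neg_log_ge∕le`), (400) (`block_neg_log_upper_letter_quadratic`), (401) (`block_neg_log_lower_letter`), (399)
(`hasFDerivAt_block_neg_log`), (388) (`clm₁_apply_eq_dot`, `symmMatrix_form_eq`, `symmMatrix_isHermitian`); (394)
`…SupResidualSecondOrderClass` (`quadratic_increment`).

WHAT IS PROVED ([folklore]; `Z(ψ) = ∫e^{−U(ω+ψ)}dN(0,M⁻¹)` (§1's first lemma over any `N(0,Γ)`)):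
* §1 `block_fderiv_neg_log_eq_bdot` (`D(−log Z)(ψ₀)[ζ] = ⟨b_D(ψ₀),ζ⟩`), `block_quadratic_part_two_sided` (`−2λΣ_iζ_i² ≤ ζᵀK_D(ψ₀)ζ ≤
  ΛΣ_Yζ²`), `block_first_order_two_sided` (`−½ΛΣ_Yζ² ≤ log Z(ψ₀+ζ) − log Z(ψ₀) + ⟨b_D,ζ⟩ ≤ λΣ_iζ_i²`), `block_neg_log_two_sided_at`
  ((400)∕(401) at the base point `ψ₀+ζ` towards `ψ₀+ζ′`);
* §2 **`block_residual_global_letter`** (`|r(ζ)| ≤ λΣ_iζ_i² + ½ΛΣ_Yζ²` for EVERY `ζ`), **`block_residual_factor_regulated`**;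
* §3 THE END **`block_residual_second_order_class`** (for ALL `ζ, ζ′` the display above, `w⁺`, `Dw⁺` written out as in (394)); §4 toy.

HONEST (what this is NOT).  The lower letters carry `Σ_i` over ALL sites because (401)'s secant hypothesis does; for a `Y`-local `U` they
reduce to `Σ_Y` (successor file); the constants ADD per step — that the NEXT class constants return to input size after blocking∕rescaling is
the CONTRACTION (β4), NOT shown; the on-ball cubic letter is (408); scalar skeleton ((A3), NC-NE7b-α UNRULED); nothing of Bałaban's asserted.
BY-NAME EFFECT ON THE WALL: NONE.  NE7b NOT PRINTED ∕ NOT PROVED; spine PROVED 0∕9; rung (B)+1 — the programme's measures remain FINITE-torus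
statements; NOT the mass gap, NOT Clay.  HONEST DEPENDENCY: continuum YM on T⁴ ⇐ BetaPertH ∧ nine spine estimates (0∕9 proved); BetaPertH ⇐
(D1) ∧ (D4) ∧ CAP+tail; G-an2-4 gates asym, D1 and NE2∕3∕4.
-/

set_option autoImplicit false
set_option maxSynthPendingDepth 2

noncomputable section

namespace Summit.QuantumFields.BalabanUV.T4Continuum.NE7b.SupBlockResidualRegulated

open MeasureTheory ProbabilityTheory Finset Real Matrix
open scoped BigOperators
open SupNextHessianMatrix (clm₁_apply_eq_dot symmMatrix_form_eq symmMatrix_isHermitian)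
open SupBlockEffectiveActionCovariance (hessian_block_neg_log_ge hessian_block_neg_log_le)
open SupBlockUpperLetter (block_neg_log_upper_letter_quadratic)
open SupBlockLowerLetter (block_neg_log_lower_letter)
open SupBlockEffectiveActionDerivative (hasFDerivAt_block_neg_log)
open SupResidualSecondOrderClass (quadratic_increment)

variable {ι : Type} [Fintype ι] [DecidableEq ι]

section Road

variable {Γ M : Matrix ι ι ℝ} {γop m lam : ℝ} {U : EuclideanSpace ℝ ι → ℝ} {U' : EuclideanSpace ℝ ι → EuclideanSpace ℝ ι →L[ℝ] ℝ}
  {U'' : EuclideanSpace ℝ ι → EuclideanSpace ℝ ι →L[ℝ] EuclideanSpace ℝ ι →L[ℝ] ℝ} {κ₀ κ₁ κ₂ a τ δ θ : ℝ}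

/-! ## §1. The three ingredients read with `b_D` and `K_D` -/

/-- **`D(−log Z)(ψ₀)[ζ] = ⟨b_D(ψ₀), ζ⟩`** for a block input (the Fréchet derivative of (399) on coordinate vectors). [folklore] -/
theorem block_fderiv_neg_log_eq_bdot (hΓ : Γ.PosSemidef) (hΓop : (γop • (1 : Matrix ι ι ℝ) - Γ).PosSemidef) (Y : Finset ι)
    (hUd : ∀ φ : EuclideanSpace ℝ ι, HasFDerivAt U (U' φ) φ) (hU'c : Continuous U')
    (hκ₀ : 0 ≤ κ₀) (hκ₁ : 0 ≤ κ₁) (ha : 0 ≤ a) (hτ : 0 < τ) (hδ : 0 < δ) (hθ0 : 0 < θ) (hθ1 : θ < 1)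
    (hκθ : (2 * κ₀ * (1 + τ) + 4 * δ) * γop ≤ θ) (hstab : ∀ φ : EuclideanSpace ℝ ι, -(κ₀ * ∑ x ∈ Y, φ x ^ 2) ≤ U φ)
    (hU'b : ∀ φ : EuclideanSpace ℝ ι, ‖U' φ‖ ≤ κ₁ * (a + ∑ x ∈ Y, φ x ^ 2)) (ψ₀ ζ : EuclideanSpace ℝ ι) :
    fderiv ℝ (fun φ : EuclideanSpace ℝ ι => -Real.log (∫ ω : EuclideanSpace ℝ ι, exp (-U (ω + φ)) ∂(multivariateGaussian 0 Γ))) ψ₀ ζ = ((fun x : ι => ((∫ ω : EuclideanSpace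
        ℝ ι, exp (-U (ω + ψ₀)) ∂(multivariateGaussian 0 Γ))⁻¹ • ∫ ω : EuclideanSpace ℝ ι, exp (-U (ω + ψ₀)) • U' (ω + ψ₀) ∂(multivariateGaussian 0 Γ))
        (EuclideanSpace.single x (1 : ℝ))) ⬝ᵥ (WithLp.ofLp ζ)) := by
  rw [(hasFDerivAt_block_neg_log hΓ hΓop Y hUd hU'c hκ₀ hκ₁ ha hτ hδ hθ0 hθ1 hκθ hstab hU'b ψ₀).fderiv]
  exact clm₁_apply_eq_dot _ ζ

/-- **The quadratic part of a block input is two-sided**: `−2λ·Σ_iζ_i² ≤ ζᵀK_D(ψ₀)ζ ≤ Λ·Σ_Yζ²` ((403)'s Hessian letters via (388)'s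
`symmMatrix_form_eq`). [folklore] -/
theorem block_quadratic_part_two_sided (hM : M.PosDef) (hfl : ∀ z : ι → ℝ, m * ∑ i, z i ^ 2 ≤ z ⬝ᵥ (M *ᵥ z)) (hΓop : (γop • (1 : Matrix ι ι ℝ) - M⁻¹).PosSemidef) (Y :
    Finset ι)
    (hUd : ∀ φ : EuclideanSpace ℝ ι, HasFDerivAt U (U' φ) φ) (hU'd : ∀ φ : EuclideanSpace ℝ ι, HasFDerivAt U' (U'' φ) φ)
    (hU''c : Continuous U'') (hκ₀ : 0 ≤ κ₀) (hκ₁ : 0 ≤ κ₁) (ha : 0 ≤ a) (hκ₂ : 0 ≤ κ₂) (hτ : 0 < τ) (hδ : 0 < δ) (hθ0 : 0 < θ) (hθ1 : θ < 1)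
    (hκθ : (2 * κ₀ * (1 + τ) + 4 * δ) * γop ≤ θ) (hstab : ∀ φ : EuclideanSpace ℝ ι, -(κ₀ * ∑ x ∈ Y, φ x ^ 2) ≤ U φ)
    (hU'b : ∀ φ : EuclideanSpace ℝ ι, ‖U' φ‖ ≤ κ₁ * (a + ∑ x ∈ Y, φ x ^ 2)) (hU''b : ∀ φ : EuclideanSpace ℝ ι, ‖U'' φ‖ ≤ κ₂) {Λ : ℝ}
    (hwup : ∀ φ φ' : EuclideanSpace ℝ ι, U φ' ≤ U φ + U' φ (φ' - φ) + Λ / 2 * ∑ x ∈ Y, (φ' x - φ x) ^ 2) (hlam : 0 ≤ lam)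
    (hUsec : ∀ s : ℝ, 0 ≤ s → s ≤ 1 → ∀ a b : EuclideanSpace ℝ ι,
      U ((1 - s) • a + s • b) - lam / 2 * (s * (1 - s)) * ∑ i, (a i - b i) ^ 2 ≤ (1 - s) * U a + s * U b)
    (hm : 2 * lam ≤ m) (ψ₀ ζ : EuclideanSpace ℝ ι) :
    -(2 * lam * (∑ i, ζ i ^ 2)) ≤ ((WithLp.ofLp ζ) ⬝ᵥ (Matrix.of fun x y : ι => (((∫ ω : EuclideanSpace ℝ ι, exp (-U (ω + ψ₀)) ∂(multivariateGaussian 0 M⁻¹))⁻¹ • (∫ ω :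
        EuclideanSpace ℝ ι, exp (-U (ω + ψ₀)) • (U'' (ω + ψ₀) - (U' (ω + ψ₀)).smulRight (U' (ω + ψ₀))) ∂(multivariateGaussian 0 M⁻¹)) + (((∫ ω : EuclideanSpace ℝ ι, exp (-U
        (ω + ψ₀)) ∂(multivariateGaussian 0 M⁻¹)) ^ 2)⁻¹ • ∫ ω : EuclideanSpace ℝ ι, exp (-U (ω + ψ₀)) • U' (ω + ψ₀) ∂(multivariateGaussian 0 M⁻¹)).smulRight (∫ ω :
        EuclideanSpace ℝ ι, exp (-U (ω + ψ₀)) • U' (ω + ψ₀) ∂(multivariateGaussian 0 M⁻¹))) (EuclideanSpace.single x (1 : ℝ)) (EuclideanSpace.single y (1 : ℝ)) + ((∫ ω :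
        EuclideanSpace ℝ ι, exp (-U (ω + ψ₀)) ∂(multivariateGaussian 0 M⁻¹))⁻¹ • (∫ ω : EuclideanSpace ℝ ι, exp (-U (ω + ψ₀)) • (U'' (ω + ψ₀) - (U' (ω + ψ₀)).smulRight (U'
        (ω + ψ₀))) ∂(multivariateGaussian 0 M⁻¹)) + (((∫ ω : EuclideanSpace ℝ ι, exp (-U (ω + ψ₀)) ∂(multivariateGaussian 0 M⁻¹)) ^ 2)⁻¹ • ∫ ω : EuclideanSpace ℝ ι, exp (-U
        (ω + ψ₀)) • U' (ω + ψ₀) ∂(multivariateGaussian 0 M⁻¹)).smulRight (∫ ω : EuclideanSpace ℝ ι, exp (-U (ω + ψ₀)) • U' (ω + ψ₀) ∂(multivariateGaussian 0 M⁻¹)))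
        (EuclideanSpace.single y (1 : ℝ)) (EuclideanSpace.single x (1 : ℝ))) / 2) *ᵥ (WithLp.ofLp ζ)) ∧
      ((WithLp.ofLp ζ) ⬝ᵥ (Matrix.of fun x y : ι => (((∫ ω : EuclideanSpace ℝ ι, exp (-U (ω + ψ₀)) ∂(multivariateGaussian 0 M⁻¹))⁻¹ • (∫ ω : EuclideanSpace ℝ ι, exp (-U (ω
          + ψ₀)) • (U'' (ω + ψ₀) - (U' (ω + ψ₀)).smulRight (U' (ω + ψ₀))) ∂(multivariateGaussian 0 M⁻¹)) + (((∫ ω : EuclideanSpace ℝ ι, exp (-U (ω + ψ₀))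
          ∂(multivariateGaussian 0 M⁻¹)) ^ 2)⁻¹ • ∫ ω : EuclideanSpace ℝ ι, exp (-U (ω + ψ₀)) • U' (ω + ψ₀) ∂(multivariateGaussian 0 M⁻¹)).smulRight (∫ ω : EuclideanSpace ℝ
          ι, exp (-U (ω + ψ₀)) • U' (ω + ψ₀) ∂(multivariateGaussian 0 M⁻¹))) (EuclideanSpace.single x (1 : ℝ)) (EuclideanSpace.single y (1 : ℝ)) + ((∫ ω : EuclideanSpace ℝ
          ι, exp (-U (ω + ψ₀)) ∂(multivariateGaussian 0 M⁻¹))⁻¹ • (∫ ω : EuclideanSpace ℝ ι, exp (-U (ω + ψ₀)) • (U'' (ω + ψ₀) - (U' (ω + ψ₀)).smulRight (U' (ω + ψ₀)))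
          ∂(multivariateGaussian 0 M⁻¹)) + (((∫ ω : EuclideanSpace ℝ ι, exp (-U (ω + ψ₀)) ∂(multivariateGaussian 0 M⁻¹)) ^ 2)⁻¹ • ∫ ω : EuclideanSpace ℝ ι, exp (-U (ω +
          ψ₀)) • U' (ω + ψ₀) ∂(multivariateGaussian 0 M⁻¹)).smulRight (∫ ω : EuclideanSpace ℝ ι, exp (-U (ω + ψ₀)) • U' (ω + ψ₀) ∂(multivariateGaussian 0 M⁻¹)))
          (EuclideanSpace.single y (1 : ℝ)) (EuclideanSpace.single x (1 : ℝ))) / 2) *ᵥ (WithLp.ofLp ζ)) ≤ Λ * (∑ x ∈ Y, ζ x ^ 2) := by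
  have hΓ : (M⁻¹).PosSemidef := hM.inv.posSemidef
  set L : EuclideanSpace ℝ ι →L[ℝ] EuclideanSpace ℝ ι →L[ℝ] ℝ := ((∫ ω : EuclideanSpace ℝ ι, exp (-U (ω + ψ₀)) ∂(multivariateGaussian 0 M⁻¹))⁻¹ • (∫ ω : EuclideanSpace ℝ ι,
      exp (-U (ω + ψ₀)) • (U'' (ω + ψ₀) - (U' (ω + ψ₀)).smulRight (U' (ω + ψ₀))) ∂(multivariateGaussian 0 M⁻¹)) + (((∫ ω : EuclideanSpace ℝ ι, exp (-U (ω + ψ₀))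
      ∂(multivariateGaussian 0 M⁻¹)) ^ 2)⁻¹ • ∫ ω : EuclideanSpace ℝ ι, exp (-U (ω + ψ₀)) • U' (ω + ψ₀) ∂(multivariateGaussian 0 M⁻¹)).smulRight (∫ ω : EuclideanSpace ℝ ι,
      exp (-U (ω + ψ₀)) • U' (ω + ψ₀) ∂(multivariateGaussian 0 M⁻¹))) with hL
  rw [symmMatrix_form_eq L ζ, hL]
  exact ⟨hessian_block_neg_log_ge hM hfl hΓop Y hUd hU'd hU''c hκ₀ hκ₁ ha hκ₂ hτ hδ hθ0 hθ1 hκθ hstab hU'b hU''b hlam hUsec hm ψ₀ ζ, hessian_block_neg_log_le hΓ hΓop Y hUd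
      hU'd hU''c hκ₀ hκ₁ ha hκ₂ hτ hδ hθ0 hθ1 hκθ hstab hU'b hU''b hwup ψ₀ ζ⟩

/-- **The first-order remainder of a block input is two-sided, GLOBALLY**: for every `ζ`,
`−½Λ·Σ_Yζ² ≤ log Z(ψ₀+ζ) − log Z(ψ₀) + ⟨b_D(ψ₀),ζ⟩ ≤ λ·Σ_iζ_i²` ((400) gives the lower, (401) the upper bound). [folklore] -/
theorem block_first_order_two_sided (hM : M.PosDef) (hfl : ∀ z : ι → ℝ, m * ∑ i, z i ^ 2 ≤ z ⬝ᵥ (M *ᵥ z)) (hΓop : (γop • (1 : Matrix ι ι ℝ) - M⁻¹).PosSemidef) (Y : Finset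
    ι)
    (hUd : ∀ φ : EuclideanSpace ℝ ι, HasFDerivAt U (U' φ) φ) (hU'c : Continuous U')
    (hκ₀ : 0 ≤ κ₀) (hκ₁ : 0 ≤ κ₁) (ha : 0 ≤ a) (hτ : 0 < τ) (hδ : 0 < δ) (hθ0 : 0 < θ) (hθ1 : θ < 1)
    (hκθ : (2 * κ₀ * (1 + τ) + 4 * δ) * γop ≤ θ) (hstab : ∀ φ : EuclideanSpace ℝ ι, -(κ₀ * ∑ x ∈ Y, φ x ^ 2) ≤ U φ)
    (hU'b : ∀ φ : EuclideanSpace ℝ ι, ‖U' φ‖ ≤ κ₁ * (a + ∑ x ∈ Y, φ x ^ 2)) {Λ : ℝ}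
    (hwup : ∀ φ φ' : EuclideanSpace ℝ ι, U φ' ≤ U φ + U' φ (φ' - φ) + Λ / 2 * ∑ x ∈ Y, (φ' x - φ x) ^ 2) (hlam : 0 ≤ lam)
    (hUsec : ∀ s : ℝ, 0 ≤ s → s ≤ 1 → ∀ a b : EuclideanSpace ℝ ι,
      U ((1 - s) • a + s • b) - lam / 2 * (s * (1 - s)) * ∑ i, (a i - b i) ^ 2 ≤ (1 - s) * U a + s * U b)
    (hm : 2 * lam ≤ m) (ψ₀ ζ : EuclideanSpace ℝ ι) :
    -(Λ / 2 * (∑ x ∈ Y, ζ x ^ 2)) ≤ Real.log (∫ ω : EuclideanSpace ℝ ι, exp (-U (ω + (ψ₀ + ζ))) ∂(multivariateGaussian 0 M⁻¹)) - Real.log (∫ ω : EuclideanSpace ℝ ι, exp (-U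
        (ω + ψ₀)) ∂(multivariateGaussian 0 M⁻¹)) + ((fun x : ι => ((∫ ω : EuclideanSpace ℝ ι, exp (-U (ω + ψ₀)) ∂(multivariateGaussian 0 M⁻¹))⁻¹ • ∫ ω : EuclideanSpace ℝ ι,
        exp (-U (ω + ψ₀)) • U' (ω + ψ₀) ∂(multivariateGaussian 0 M⁻¹)) (EuclideanSpace.single x (1 : ℝ))) ⬝ᵥ (WithLp.ofLp ζ)) ∧
      Real.log (∫ ω : EuclideanSpace ℝ ι, exp (-U (ω + (ψ₀ + ζ))) ∂(multivariateGaussian 0 M⁻¹)) - Real.log (∫ ω : EuclideanSpace ℝ ι, exp (-U (ω + ψ₀))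
          ∂(multivariateGaussian 0 M⁻¹)) + ((fun x : ι => ((∫ ω : EuclideanSpace ℝ ι, exp (-U (ω + ψ₀)) ∂(multivariateGaussian 0 M⁻¹))⁻¹ • ∫ ω : EuclideanSpace ℝ ι, exp (-U
          (ω + ψ₀)) • U' (ω + ψ₀) ∂(multivariateGaussian 0 M⁻¹)) (EuclideanSpace.single x (1 : ℝ))) ⬝ᵥ (WithLp.ofLp ζ)) ≤ lam * (∑ i, ζ i ^ 2) := by
  have hΓ : (M⁻¹).PosSemidef := hM.inv.posSemidef
  have hup := block_neg_log_upper_letter_quadratic hΓ hΓop Y hUd hU'c hκ₀ hκ₁ ha hτ hδ hθ0 hθ1 hκθ hstab hU'b hwup ψ₀ (ψ₀ + ζ)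
  have hlo := block_neg_log_lower_letter hM hfl hΓop Y hUd hU'c hκ₀ hκ₁ ha hτ hδ hθ0 hθ1 hκθ hstab hU'b hlam hUsec hm ψ₀ (ψ₀ + ζ)
  have hb := block_fderiv_neg_log_eq_bdot hΓ hΓop Y hUd hU'c hκ₀ hκ₁ ha hτ hδ hθ0 hθ1 hκθ hstab hU'b ψ₀ ζ
  simp only [PiLp.add_apply, add_sub_cancel_left] at hup hlo
  rw [hb] at hup hlo
  constructor
  · linarith
  · linarith

/-- **The two-sided letters of `W = −log Z` at the base point `ψ₀ + ζ` towards `ψ₀ + ζ′`** ((400) upper on `Y`, (401) lower). [folklore] -/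
theorem block_neg_log_two_sided_at (hM : M.PosDef) (hfl : ∀ z : ι → ℝ, m * ∑ i, z i ^ 2 ≤ z ⬝ᵥ (M *ᵥ z)) (hΓop : (γop • (1 : Matrix ι ι ℝ) - M⁻¹).PosSemidef) (Y : Finset ι)
    (hUd : ∀ φ : EuclideanSpace ℝ ι, HasFDerivAt U (U' φ) φ) (hU'c : Continuous U')
    (hκ₀ : 0 ≤ κ₀) (hκ₁ : 0 ≤ κ₁) (ha : 0 ≤ a) (hτ : 0 < τ) (hδ : 0 < δ) (hθ0 : 0 < θ) (hθ1 : θ < 1)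
    (hκθ : (2 * κ₀ * (1 + τ) + 4 * δ) * γop ≤ θ) (hstab : ∀ φ : EuclideanSpace ℝ ι, -(κ₀ * ∑ x ∈ Y, φ x ^ 2) ≤ U φ)
    (hU'b : ∀ φ : EuclideanSpace ℝ ι, ‖U' φ‖ ≤ κ₁ * (a + ∑ x ∈ Y, φ x ^ 2)) {Λ : ℝ}
    (hwup : ∀ φ φ' : EuclideanSpace ℝ ι, U φ' ≤ U φ + U' φ (φ' - φ) + Λ / 2 * ∑ x ∈ Y, (φ' x - φ x) ^ 2) (hlam : 0 ≤ lam)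
    (hUsec : ∀ s : ℝ, 0 ≤ s → s ≤ 1 → ∀ a b : EuclideanSpace ℝ ι,
      U ((1 - s) • a + s • b) - lam / 2 * (s * (1 - s)) * ∑ i, (a i - b i) ^ 2 ≤ (1 - s) * U a + s * U b)
    (hm : 2 * lam ≤ m) (ψ₀ ζ ζ' : EuclideanSpace ℝ ι) :
    -Real.log (∫ ω : EuclideanSpace ℝ ι, exp (-U (ω + (ψ₀ + ζ'))) ∂(multivariateGaussian 0 M⁻¹)) ≤ -Real.log (∫ ω : EuclideanSpace ℝ ι, exp (-U (ω + (ψ₀ + ζ)))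
        ∂(multivariateGaussian 0 M⁻¹)) + fderiv ℝ (fun φ : EuclideanSpace ℝ ι => -Real.log (∫ ω : EuclideanSpace ℝ ι, exp (-U (ω + φ)) ∂(multivariateGaussian 0 M⁻¹))) (ψ₀ +
        ζ) (ζ' - ζ) + Λ / 2 * (∑ x ∈ Y, (ζ' x - ζ x) ^ 2) ∧
      -Real.log (∫ ω : EuclideanSpace ℝ ι, exp (-U (ω + (ψ₀ + ζ))) ∂(multivariateGaussian 0 M⁻¹)) + fderiv ℝ (fun φ : EuclideanSpace ℝ ι => -Real.log (∫ ω : EuclideanSpace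
          ℝ ι, exp (-U (ω + φ)) ∂(multivariateGaussian 0 M⁻¹))) (ψ₀ + ζ) (ζ' - ζ) - lam * (∑ i, (ζ' i - ζ i) ^ 2) ≤ -Real.log (∫ ω : EuclideanSpace ℝ ι, exp (-U (ω + (ψ₀ +
          ζ'))) ∂(multivariateGaussian 0 M⁻¹)) := by
  have hΓ : (M⁻¹).PosSemidef := hM.inv.posSemidef
  have hup := block_neg_log_upper_letter_quadratic hΓ hΓop Y hUd hU'c hκ₀ hκ₁ ha hτ hδ hθ0 hθ1 hκθ hstab hU'b hwup (ψ₀ + ζ) (ψ₀ + ζ')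
  have hlo := block_neg_log_lower_letter hM hfl hΓop Y hUd hU'c hκ₀ hκ₁ ha hτ hδ hθ0 hθ1 hκθ hstab hU'b hlam hUsec hm (ψ₀ + ζ) (ψ₀ + ζ')
  simp only [PiLp.add_apply, add_sub_add_left_eq_sub] at hup hlo
  exact ⟨hup, hlo⟩

/-! ## §2. The residual's global letter and the regulated residual factor -/

/-- **THE BLOCK RESIDUAL'S GLOBAL LETTER**: for EVERY `ζ`, `|r(ζ)| ≤ λ·Σ_iζ_i² + ½Λ·Σ_Yζ²` with
`r(ζ) = log Z(ψ₀+ζ) − log Z(ψ₀) + ⟨b_D(ψ₀),ζ⟩ + ½ζᵀK_D(ψ₀)ζ`. [folklore] -/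
theorem block_residual_global_letter (hM : M.PosDef) (hfl : ∀ z : ι → ℝ, m * ∑ i, z i ^ 2 ≤ z ⬝ᵥ (M *ᵥ z)) (hΓop : (γop • (1 : Matrix ι ι ℝ) - M⁻¹).PosSemidef) (Y : Finset
    ι)
    (hUd : ∀ φ : EuclideanSpace ℝ ι, HasFDerivAt U (U' φ) φ) (hU'd : ∀ φ : EuclideanSpace ℝ ι, HasFDerivAt U' (U'' φ) φ)
    (hU''c : Continuous U'') (hκ₀ : 0 ≤ κ₀) (hκ₁ : 0 ≤ κ₁) (ha : 0 ≤ a) (hκ₂ : 0 ≤ κ₂) (hτ : 0 < τ) (hδ : 0 < δ) (hθ0 : 0 < θ) (hθ1 : θ < 1)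
    (hκθ : (2 * κ₀ * (1 + τ) + 4 * δ) * γop ≤ θ) (hstab : ∀ φ : EuclideanSpace ℝ ι, -(κ₀ * ∑ x ∈ Y, φ x ^ 2) ≤ U φ)
    (hU'b : ∀ φ : EuclideanSpace ℝ ι, ‖U' φ‖ ≤ κ₁ * (a + ∑ x ∈ Y, φ x ^ 2)) (hU''b : ∀ φ : EuclideanSpace ℝ ι, ‖U'' φ‖ ≤ κ₂) {Λ : ℝ}
    (hwup : ∀ φ φ' : EuclideanSpace ℝ ι, U φ' ≤ U φ + U' φ (φ' - φ) + Λ / 2 * ∑ x ∈ Y, (φ' x - φ x) ^ 2) (hlam : 0 ≤ lam)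
    (hUsec : ∀ s : ℝ, 0 ≤ s → s ≤ 1 → ∀ a b : EuclideanSpace ℝ ι,
      U ((1 - s) • a + s • b) - lam / 2 * (s * (1 - s)) * ∑ i, (a i - b i) ^ 2 ≤ (1 - s) * U a + s * U b)
    (hm : 2 * lam ≤ m) (ψ₀ ζ : EuclideanSpace ℝ ι) :
    |(Real.log (∫ ω : EuclideanSpace ℝ ι, exp (-U (ω + (ψ₀ + ζ))) ∂(multivariateGaussian 0 M⁻¹)) - Real.log (∫ ω : EuclideanSpace ℝ ι, exp (-U (ω + ψ₀))
        ∂(multivariateGaussian 0 M⁻¹)) + ((fun x : ι => ((∫ ω : EuclideanSpace ℝ ι, exp (-U (ω + ψ₀)) ∂(multivariateGaussian 0 M⁻¹))⁻¹ • ∫ ω : EuclideanSpace ℝ ι, exp (-U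
        (ω + ψ₀)) • U' (ω + ψ₀) ∂(multivariateGaussian 0 M⁻¹)) (EuclideanSpace.single x (1 : ℝ))) ⬝ᵥ (WithLp.ofLp ζ)) + ((WithLp.ofLp ζ) ⬝ᵥ (Matrix.of fun x y : ι => (((∫ ω
        : EuclideanSpace ℝ ι, exp (-U (ω + ψ₀)) ∂(multivariateGaussian 0 M⁻¹))⁻¹ • (∫ ω : EuclideanSpace ℝ ι, exp (-U (ω + ψ₀)) • (U'' (ω + ψ₀) - (U' (ω + ψ₀)).smulRight
        (U' (ω + ψ₀))) ∂(multivariateGaussian 0 M⁻¹)) + (((∫ ω : EuclideanSpace ℝ ι, exp (-U (ω + ψ₀)) ∂(multivariateGaussian 0 M⁻¹)) ^ 2)⁻¹ • ∫ ω : EuclideanSpace ℝ ι, exp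
        (-U (ω + ψ₀)) • U' (ω + ψ₀) ∂(multivariateGaussian 0 M⁻¹)).smulRight (∫ ω : EuclideanSpace ℝ ι, exp (-U (ω + ψ₀)) • U' (ω + ψ₀) ∂(multivariateGaussian 0 M⁻¹)))
        (EuclideanSpace.single x (1 : ℝ)) (EuclideanSpace.single y (1 : ℝ)) + ((∫ ω : EuclideanSpace ℝ ι, exp (-U (ω + ψ₀)) ∂(multivariateGaussian 0 M⁻¹))⁻¹ • (∫ ω :
        EuclideanSpace ℝ ι, exp (-U (ω + ψ₀)) • (U'' (ω + ψ₀) - (U' (ω + ψ₀)).smulRight (U' (ω + ψ₀))) ∂(multivariateGaussian 0 M⁻¹)) + (((∫ ω : EuclideanSpace ℝ ι, exp (-U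
        (ω + ψ₀)) ∂(multivariateGaussian 0 M⁻¹)) ^ 2)⁻¹ • ∫ ω : EuclideanSpace ℝ ι, exp (-U (ω + ψ₀)) • U' (ω + ψ₀) ∂(multivariateGaussian 0 M⁻¹)).smulRight (∫ ω :
        EuclideanSpace ℝ ι, exp (-U (ω + ψ₀)) • U' (ω + ψ₀) ∂(multivariateGaussian 0 M⁻¹))) (EuclideanSpace.single y (1 : ℝ)) (EuclideanSpace.single x (1 : ℝ))) / 2) *ᵥ
        (WithLp.ofLp ζ)) / 2)| ≤ (lam * (∑ i, ζ i ^ 2) + Λ / 2 * (∑ x ∈ Y, ζ x ^ 2)) := by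
  have hU'c : Continuous U' := continuous_iff_continuousAt.2 fun φ => (hU'd φ).continuousAt
  obtain ⟨q1, q2⟩ := block_quadratic_part_two_sided hM hfl hΓop Y hUd hU'd hU''c hκ₀ hκ₁ ha hκ₂ hτ hδ hθ0 hθ1 hκθ hstab hU'b hU''b hwup hlam hUsec hm ψ₀ ζ
  obtain ⟨f1, f2⟩ := block_first_order_two_sided hM hfl hΓop Y hUd hU'c hκ₀ hκ₁ ha hτ hδ hθ0 hθ1 hκθ hstab hU'b hwup hlam hUsec hm ψ₀ ζ
  rw [abs_le]
  constructor
  · linarith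
  · linarith

/-- **THE BLOCK RESIDUAL FACTOR IS GLOBALLY REGULATED**: for EVERY `ζ`, `e^{−(λΣ_iζ_i² + ½ΛΣ_Yζ²)} ≤ e^{r(ζ)} ≤ e^{λΣ_iζ_i² + ½ΛΣ_Yζ²}` —
stability (and non-degeneracy) of the factor that re-enters the road, with the rate REGENERATED from the current second-order class. [folklore] -/
theorem block_residual_factor_regulated (hM : M.PosDef) (hfl : ∀ z : ι → ℝ, m * ∑ i, z i ^ 2 ≤ z ⬝ᵥ (M *ᵥ z)) (hΓop : (γop • (1 : Matrix ι ι ℝ) - M⁻¹).PosSemidef) (Y :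
    Finset ι)
    (hUd : ∀ φ : EuclideanSpace ℝ ι, HasFDerivAt U (U' φ) φ) (hU'd : ∀ φ : EuclideanSpace ℝ ι, HasFDerivAt U' (U'' φ) φ)
    (hU''c : Continuous U'') (hκ₀ : 0 ≤ κ₀) (hκ₁ : 0 ≤ κ₁) (ha : 0 ≤ a) (hκ₂ : 0 ≤ κ₂) (hτ : 0 < τ) (hδ : 0 < δ) (hθ0 : 0 < θ) (hθ1 : θ < 1)
    (hκθ : (2 * κ₀ * (1 + τ) + 4 * δ) * γop ≤ θ) (hstab : ∀ φ : EuclideanSpace ℝ ι, -(κ₀ * ∑ x ∈ Y, φ x ^ 2) ≤ U φ)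
    (hU'b : ∀ φ : EuclideanSpace ℝ ι, ‖U' φ‖ ≤ κ₁ * (a + ∑ x ∈ Y, φ x ^ 2)) (hU''b : ∀ φ : EuclideanSpace ℝ ι, ‖U'' φ‖ ≤ κ₂) {Λ : ℝ}
    (hwup : ∀ φ φ' : EuclideanSpace ℝ ι, U φ' ≤ U φ + U' φ (φ' - φ) + Λ / 2 * ∑ x ∈ Y, (φ' x - φ x) ^ 2) (hlam : 0 ≤ lam)
    (hUsec : ∀ s : ℝ, 0 ≤ s → s ≤ 1 → ∀ a b : EuclideanSpace ℝ ι,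
      U ((1 - s) • a + s • b) - lam / 2 * (s * (1 - s)) * ∑ i, (a i - b i) ^ 2 ≤ (1 - s) * U a + s * U b)
    (hm : 2 * lam ≤ m) (ψ₀ ζ : EuclideanSpace ℝ ι) :
    Real.exp (Real.log (∫ ω : EuclideanSpace ℝ ι, exp (-U (ω + (ψ₀ + ζ))) ∂(multivariateGaussian 0 M⁻¹)) - Real.log (∫ ω : EuclideanSpace ℝ ι, exp (-U (ω + ψ₀))
        ∂(multivariateGaussian 0 M⁻¹)) + ((fun x : ι => ((∫ ω : EuclideanSpace ℝ ι, exp (-U (ω + ψ₀)) ∂(multivariateGaussian 0 M⁻¹))⁻¹ • ∫ ω : EuclideanSpace ℝ ι, exp (-U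
        (ω + ψ₀)) • U' (ω + ψ₀) ∂(multivariateGaussian 0 M⁻¹)) (EuclideanSpace.single x (1 : ℝ))) ⬝ᵥ (WithLp.ofLp ζ)) + ((WithLp.ofLp ζ) ⬝ᵥ (Matrix.of fun x y : ι => (((∫ ω
        : EuclideanSpace ℝ ι, exp (-U (ω + ψ₀)) ∂(multivariateGaussian 0 M⁻¹))⁻¹ • (∫ ω : EuclideanSpace ℝ ι, exp (-U (ω + ψ₀)) • (U'' (ω + ψ₀) - (U' (ω + ψ₀)).smulRight
        (U' (ω + ψ₀))) ∂(multivariateGaussian 0 M⁻¹)) + (((∫ ω : EuclideanSpace ℝ ι, exp (-U (ω + ψ₀)) ∂(multivariateGaussian 0 M⁻¹)) ^ 2)⁻¹ • ∫ ω : EuclideanSpace ℝ ι, exp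
        (-U (ω + ψ₀)) • U' (ω + ψ₀) ∂(multivariateGaussian 0 M⁻¹)).smulRight (∫ ω : EuclideanSpace ℝ ι, exp (-U (ω + ψ₀)) • U' (ω + ψ₀) ∂(multivariateGaussian 0 M⁻¹)))
        (EuclideanSpace.single x (1 : ℝ)) (EuclideanSpace.single y (1 : ℝ)) + ((∫ ω : EuclideanSpace ℝ ι, exp (-U (ω + ψ₀)) ∂(multivariateGaussian 0 M⁻¹))⁻¹ • (∫ ω :
        EuclideanSpace ℝ ι, exp (-U (ω + ψ₀)) • (U'' (ω + ψ₀) - (U' (ω + ψ₀)).smulRight (U' (ω + ψ₀))) ∂(multivariateGaussian 0 M⁻¹)) + (((∫ ω : EuclideanSpace ℝ ι, exp (-U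
        (ω + ψ₀)) ∂(multivariateGaussian 0 M⁻¹)) ^ 2)⁻¹ • ∫ ω : EuclideanSpace ℝ ι, exp (-U (ω + ψ₀)) • U' (ω + ψ₀) ∂(multivariateGaussian 0 M⁻¹)).smulRight (∫ ω :
        EuclideanSpace ℝ ι, exp (-U (ω + ψ₀)) • U' (ω + ψ₀) ∂(multivariateGaussian 0 M⁻¹))) (EuclideanSpace.single y (1 : ℝ)) (EuclideanSpace.single x (1 : ℝ))) / 2) *ᵥ
        (WithLp.ofLp ζ)) / 2) ≤ Real.exp (lam * (∑ i, ζ i ^ 2) + Λ / 2 * (∑ x ∈ Y, ζ x ^ 2)) ∧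
      Real.exp (-(lam * (∑ i, ζ i ^ 2) + Λ / 2 * (∑ x ∈ Y, ζ x ^ 2))) ≤ Real.exp (Real.log (∫ ω : EuclideanSpace ℝ ι, exp (-U (ω + (ψ₀ + ζ))) ∂(multivariateGaussian 0 M⁻¹))
          - Real.log (∫ ω : EuclideanSpace ℝ ι, exp (-U (ω + ψ₀)) ∂(multivariateGaussian 0 M⁻¹)) + ((fun x : ι => ((∫ ω : EuclideanSpace ℝ ι, exp (-U (ω + ψ₀))
          ∂(multivariateGaussian 0 M⁻¹))⁻¹ • ∫ ω : EuclideanSpace ℝ ι, exp (-U (ω + ψ₀)) • U' (ω + ψ₀) ∂(multivariateGaussian 0 M⁻¹)) (EuclideanSpace.single x (1 : ℝ))) ⬝ᵥ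
          (WithLp.ofLp ζ)) + ((WithLp.ofLp ζ) ⬝ᵥ (Matrix.of fun x y : ι => (((∫ ω : EuclideanSpace ℝ ι, exp (-U (ω + ψ₀)) ∂(multivariateGaussian 0 M⁻¹))⁻¹ • (∫ ω :
          EuclideanSpace ℝ ι, exp (-U (ω + ψ₀)) • (U'' (ω + ψ₀) - (U' (ω + ψ₀)).smulRight (U' (ω + ψ₀))) ∂(multivariateGaussian 0 M⁻¹)) + (((∫ ω : EuclideanSpace ℝ ι, exp
          (-U (ω + ψ₀)) ∂(multivariateGaussian 0 M⁻¹)) ^ 2)⁻¹ • ∫ ω : EuclideanSpace ℝ ι, exp (-U (ω + ψ₀)) • U' (ω + ψ₀) ∂(multivariateGaussian 0 M⁻¹)).smulRight (∫ ω :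
          EuclideanSpace ℝ ι, exp (-U (ω + ψ₀)) • U' (ω + ψ₀) ∂(multivariateGaussian 0 M⁻¹))) (EuclideanSpace.single x (1 : ℝ)) (EuclideanSpace.single y (1 : ℝ)) + ((∫ ω :
          EuclideanSpace ℝ ι, exp (-U (ω + ψ₀)) ∂(multivariateGaussian 0 M⁻¹))⁻¹ • (∫ ω : EuclideanSpace ℝ ι, exp (-U (ω + ψ₀)) • (U'' (ω + ψ₀) - (U' (ω + ψ₀)).smulRight
          (U' (ω + ψ₀))) ∂(multivariateGaussian 0 M⁻¹)) + (((∫ ω : EuclideanSpace ℝ ι, exp (-U (ω + ψ₀)) ∂(multivariateGaussian 0 M⁻¹)) ^ 2)⁻¹ • ∫ ω : EuclideanSpace ℝ ι,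
          exp (-U (ω + ψ₀)) • U' (ω + ψ₀) ∂(multivariateGaussian 0 M⁻¹)).smulRight (∫ ω : EuclideanSpace ℝ ι, exp (-U (ω + ψ₀)) • U' (ω + ψ₀) ∂(multivariateGaussian 0
          M⁻¹))) (EuclideanSpace.single y (1 : ℝ)) (EuclideanSpace.single x (1 : ℝ))) / 2) *ᵥ (WithLp.ofLp ζ)) / 2) := by
  have h := block_residual_global_letter hM hfl hΓop Y hUd hU'd hU''c hκ₀ hκ₁ ha hκ₂ hτ hδ hθ0 hθ1 hκθ hstab hU'b hU''b hwup hlam hUsec hm ψ₀ ζ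
  rw [abs_le] at h
  exact ⟨Real.exp_le_exp.2 h.2, Real.exp_le_exp.2 h.1⟩

/-! ## §3. THE END: the block residual reproduces the two-sided second-order class -/

/-- **THE BLOCK RESIDUAL IS IN THE TWO-SIDED SECOND-ORDER CLASS.**  Under §1's hypotheses, for ALL `ζ, ζ′`: writing `W = −log Z`,
`K = K_D(ψ₀)` and `w⁺(ζ) = W(ψ₀+ζ) − W(ψ₀) − ⟨b_D,ζ⟩ − ½ζᵀKζ`, the increment `w⁺(ζ′) − w⁺(ζ) − Dw⁺(ζ)(ζ′−ζ)` (in which `W(ψ₀)` and the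
`⟨b_D,·⟩` parts cancel identically, `Dw⁺(ζ)(ζ′−ζ) = DW(ψ₀+ζ)(ζ′−ζ) − ⟨b_D,ζ′−ζ⟩ − ζᵀK(ζ′−ζ)`) equals
`[W(ψ₀+ζ′) − W(ψ₀+ζ) − ½(ζ′ᵀKζ′ − ζᵀKζ)] − [DW(ψ₀+ζ)(ζ′−ζ) − ζᵀK(ζ′−ζ)]` and satisfies
`−(λΣ_i(ζ′−ζ)_i² + ½ΛΣ_Y(ζ′−ζ)²) ≤ · ≤ ½ΛΣ_Y(ζ′−ζ)² + λΣ_i(ζ′−ζ)_i²`. [folklore] -/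
theorem block_residual_second_order_class (hM : M.PosDef) (hfl : ∀ z : ι → ℝ, m * ∑ i, z i ^ 2 ≤ z ⬝ᵥ (M *ᵥ z)) (hΓop : (γop • (1 : Matrix ι ι ℝ) - M⁻¹).PosSemidef) (Y :
    Finset ι)
    (hUd : ∀ φ : EuclideanSpace ℝ ι, HasFDerivAt U (U' φ) φ) (hU'd : ∀ φ : EuclideanSpace ℝ ι, HasFDerivAt U' (U'' φ) φ)
    (hU''c : Continuous U'') (hκ₀ : 0 ≤ κ₀) (hκ₁ : 0 ≤ κ₁) (ha : 0 ≤ a) (hκ₂ : 0 ≤ κ₂) (hτ : 0 < τ) (hδ : 0 < δ) (hθ0 : 0 < θ) (hθ1 : θ < 1)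
    (hκθ : (2 * κ₀ * (1 + τ) + 4 * δ) * γop ≤ θ) (hstab : ∀ φ : EuclideanSpace ℝ ι, -(κ₀ * ∑ x ∈ Y, φ x ^ 2) ≤ U φ)
    (hU'b : ∀ φ : EuclideanSpace ℝ ι, ‖U' φ‖ ≤ κ₁ * (a + ∑ x ∈ Y, φ x ^ 2)) (hU''b : ∀ φ : EuclideanSpace ℝ ι, ‖U'' φ‖ ≤ κ₂) {Λ : ℝ}
    (hwup : ∀ φ φ' : EuclideanSpace ℝ ι, U φ' ≤ U φ + U' φ (φ' - φ) + Λ / 2 * ∑ x ∈ Y, (φ' x - φ x) ^ 2) (hlam : 0 ≤ lam)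
    (hUsec : ∀ s : ℝ, 0 ≤ s → s ≤ 1 → ∀ a b : EuclideanSpace ℝ ι,
      U ((1 - s) • a + s • b) - lam / 2 * (s * (1 - s)) * ∑ i, (a i - b i) ^ 2 ≤ (1 - s) * U a + s * U b)
    (hm : 2 * lam ≤ m) (ψ₀ ζ ζ' : EuclideanSpace ℝ ι) :
    -(lam * (∑ i, (ζ' i - ζ i) ^ 2) + Λ / 2 * (∑ x ∈ Y, (ζ' x - ζ x) ^ 2)) ≤ (-Real.log (∫ ω : EuclideanSpace ℝ ι, exp (-U (ω + (ψ₀ + ζ'))) ∂(multivariateGaussian 0 M⁻¹)) -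
        -Real.log (∫ ω : EuclideanSpace ℝ ι, exp (-U (ω + (ψ₀ + ζ))) ∂(multivariateGaussian 0 M⁻¹)) - (((WithLp.ofLp ζ') ⬝ᵥ (Matrix.of fun x y : ι => (((∫ ω :
        EuclideanSpace ℝ ι, exp (-U (ω + ψ₀)) ∂(multivariateGaussian 0 M⁻¹))⁻¹ • (∫ ω : EuclideanSpace ℝ ι, exp (-U (ω + ψ₀)) • (U'' (ω + ψ₀) - (U' (ω + ψ₀)).smulRight (U'
        (ω + ψ₀))) ∂(multivariateGaussian 0 M⁻¹)) + (((∫ ω : EuclideanSpace ℝ ι, exp (-U (ω + ψ₀)) ∂(multivariateGaussian 0 M⁻¹)) ^ 2)⁻¹ • ∫ ω : EuclideanSpace ℝ ι, exp (-U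
        (ω + ψ₀)) • U' (ω + ψ₀) ∂(multivariateGaussian 0 M⁻¹)).smulRight (∫ ω : EuclideanSpace ℝ ι, exp (-U (ω + ψ₀)) • U' (ω + ψ₀) ∂(multivariateGaussian 0 M⁻¹)))
        (EuclideanSpace.single x (1 : ℝ)) (EuclideanSpace.single y (1 : ℝ)) + ((∫ ω : EuclideanSpace ℝ ι, exp (-U (ω + ψ₀)) ∂(multivariateGaussian 0 M⁻¹))⁻¹ • (∫ ω :
        EuclideanSpace ℝ ι, exp (-U (ω + ψ₀)) • (U'' (ω + ψ₀) - (U' (ω + ψ₀)).smulRight (U' (ω + ψ₀))) ∂(multivariateGaussian 0 M⁻¹)) + (((∫ ω : EuclideanSpace ℝ ι, exp (-U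
        (ω + ψ₀)) ∂(multivariateGaussian 0 M⁻¹)) ^ 2)⁻¹ • ∫ ω : EuclideanSpace ℝ ι, exp (-U (ω + ψ₀)) • U' (ω + ψ₀) ∂(multivariateGaussian 0 M⁻¹)).smulRight (∫ ω :
        EuclideanSpace ℝ ι, exp (-U (ω + ψ₀)) • U' (ω + ψ₀) ∂(multivariateGaussian 0 M⁻¹))) (EuclideanSpace.single y (1 : ℝ)) (EuclideanSpace.single x (1 : ℝ))) / 2) *ᵥ
        (WithLp.ofLp ζ')) - ((WithLp.ofLp ζ) ⬝ᵥ (Matrix.of fun x y : ι => (((∫ ω : EuclideanSpace ℝ ι, exp (-U (ω + ψ₀)) ∂(multivariateGaussian 0 M⁻¹))⁻¹ • (∫ ω :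
        EuclideanSpace ℝ ι, exp (-U (ω + ψ₀)) • (U'' (ω + ψ₀) - (U' (ω + ψ₀)).smulRight (U' (ω + ψ₀))) ∂(multivariateGaussian 0 M⁻¹)) + (((∫ ω : EuclideanSpace ℝ ι, exp (-U
        (ω + ψ₀)) ∂(multivariateGaussian 0 M⁻¹)) ^ 2)⁻¹ • ∫ ω : EuclideanSpace ℝ ι, exp (-U (ω + ψ₀)) • U' (ω + ψ₀) ∂(multivariateGaussian 0 M⁻¹)).smulRight (∫ ω :
        EuclideanSpace ℝ ι, exp (-U (ω + ψ₀)) • U' (ω + ψ₀) ∂(multivariateGaussian 0 M⁻¹))) (EuclideanSpace.single x (1 : ℝ)) (EuclideanSpace.single y (1 : ℝ)) + ((∫ ω :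
        EuclideanSpace ℝ ι, exp (-U (ω + ψ₀)) ∂(multivariateGaussian 0 M⁻¹))⁻¹ • (∫ ω : EuclideanSpace ℝ ι, exp (-U (ω + ψ₀)) • (U'' (ω + ψ₀) - (U' (ω + ψ₀)).smulRight (U'
        (ω + ψ₀))) ∂(multivariateGaussian 0 M⁻¹)) + (((∫ ω : EuclideanSpace ℝ ι, exp (-U (ω + ψ₀)) ∂(multivariateGaussian 0 M⁻¹)) ^ 2)⁻¹ • ∫ ω : EuclideanSpace ℝ ι, exp (-U
        (ω + ψ₀)) • U' (ω + ψ₀) ∂(multivariateGaussian 0 M⁻¹)).smulRight (∫ ω : EuclideanSpace ℝ ι, exp (-U (ω + ψ₀)) • U' (ω + ψ₀) ∂(multivariateGaussian 0 M⁻¹)))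
        (EuclideanSpace.single y (1 : ℝ)) (EuclideanSpace.single x (1 : ℝ))) / 2) *ᵥ (WithLp.ofLp ζ))) / 2) - (fderiv ℝ (fun φ : EuclideanSpace ℝ ι => -Real.log (∫ ω :
        EuclideanSpace ℝ ι, exp (-U (ω + φ)) ∂(multivariateGaussian 0 M⁻¹))) (ψ₀ + ζ) (ζ' - ζ) - ((WithLp.ofLp ζ) ⬝ᵥ (Matrix.of fun x y : ι => (((∫ ω : EuclideanSpace ℝ ι,
        exp (-U (ω + ψ₀)) ∂(multivariateGaussian 0 M⁻¹))⁻¹ • (∫ ω : EuclideanSpace ℝ ι, exp (-U (ω + ψ₀)) • (U'' (ω + ψ₀) - (U' (ω + ψ₀)).smulRight (U' (ω + ψ₀)))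
        ∂(multivariateGaussian 0 M⁻¹)) + (((∫ ω : EuclideanSpace ℝ ι, exp (-U (ω + ψ₀)) ∂(multivariateGaussian 0 M⁻¹)) ^ 2)⁻¹ • ∫ ω : EuclideanSpace ℝ ι, exp (-U (ω + ψ₀))
        • U' (ω + ψ₀) ∂(multivariateGaussian 0 M⁻¹)).smulRight (∫ ω : EuclideanSpace ℝ ι, exp (-U (ω + ψ₀)) • U' (ω + ψ₀) ∂(multivariateGaussian 0 M⁻¹)))
        (EuclideanSpace.single x (1 : ℝ)) (EuclideanSpace.single y (1 : ℝ)) + ((∫ ω : EuclideanSpace ℝ ι, exp (-U (ω + ψ₀)) ∂(multivariateGaussian 0 M⁻¹))⁻¹ • (∫ ω :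
        EuclideanSpace ℝ ι, exp (-U (ω + ψ₀)) • (U'' (ω + ψ₀) - (U' (ω + ψ₀)).smulRight (U' (ω + ψ₀))) ∂(multivariateGaussian 0 M⁻¹)) + (((∫ ω : EuclideanSpace ℝ ι, exp (-U
        (ω + ψ₀)) ∂(multivariateGaussian 0 M⁻¹)) ^ 2)⁻¹ • ∫ ω : EuclideanSpace ℝ ι, exp (-U (ω + ψ₀)) • U' (ω + ψ₀) ∂(multivariateGaussian 0 M⁻¹)).smulRight (∫ ω :
        EuclideanSpace ℝ ι, exp (-U (ω + ψ₀)) • U' (ω + ψ₀) ∂(multivariateGaussian 0 M⁻¹))) (EuclideanSpace.single y (1 : ℝ)) (EuclideanSpace.single x (1 : ℝ))) / 2) *ᵥ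
        (WithLp.ofLp (ζ' - ζ)))) ∧
      (-Real.log (∫ ω : EuclideanSpace ℝ ι, exp (-U (ω + (ψ₀ + ζ'))) ∂(multivariateGaussian 0 M⁻¹)) - -Real.log (∫ ω : EuclideanSpace ℝ ι, exp (-U (ω + (ψ₀ + ζ)))
          ∂(multivariateGaussian 0 M⁻¹)) - (((WithLp.ofLp ζ') ⬝ᵥ (Matrix.of fun x y : ι => (((∫ ω : EuclideanSpace ℝ ι, exp (-U (ω + ψ₀)) ∂(multivariateGaussian 0 M⁻¹))⁻¹ •
          (∫ ω : EuclideanSpace ℝ ι, exp (-U (ω + ψ₀)) • (U'' (ω + ψ₀) - (U' (ω + ψ₀)).smulRight (U' (ω + ψ₀))) ∂(multivariateGaussian 0 M⁻¹)) + (((∫ ω : EuclideanSpace ℝ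
          ι, exp (-U (ω + ψ₀)) ∂(multivariateGaussian 0 M⁻¹)) ^ 2)⁻¹ • ∫ ω : EuclideanSpace ℝ ι, exp (-U (ω + ψ₀)) • U' (ω + ψ₀) ∂(multivariateGaussian 0 M⁻¹)).smulRight (∫
          ω : EuclideanSpace ℝ ι, exp (-U (ω + ψ₀)) • U' (ω + ψ₀) ∂(multivariateGaussian 0 M⁻¹))) (EuclideanSpace.single x (1 : ℝ)) (EuclideanSpace.single y (1 : ℝ)) + ((∫
          ω : EuclideanSpace ℝ ι, exp (-U (ω + ψ₀)) ∂(multivariateGaussian 0 M⁻¹))⁻¹ • (∫ ω : EuclideanSpace ℝ ι, exp (-U (ω + ψ₀)) • (U'' (ω + ψ₀) - (U' (ω +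
          ψ₀)).smulRight (U' (ω + ψ₀))) ∂(multivariateGaussian 0 M⁻¹)) + (((∫ ω : EuclideanSpace ℝ ι, exp (-U (ω + ψ₀)) ∂(multivariateGaussian 0 M⁻¹)) ^ 2)⁻¹ • ∫ ω :
          EuclideanSpace ℝ ι, exp (-U (ω + ψ₀)) • U' (ω + ψ₀) ∂(multivariateGaussian 0 M⁻¹)).smulRight (∫ ω : EuclideanSpace ℝ ι, exp (-U (ω + ψ₀)) • U' (ω + ψ₀)
          ∂(multivariateGaussian 0 M⁻¹))) (EuclideanSpace.single y (1 : ℝ)) (EuclideanSpace.single x (1 : ℝ))) / 2) *ᵥ (WithLp.ofLp ζ')) - ((WithLp.ofLp ζ) ⬝ᵥ (Matrix.of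
          fun x y : ι => (((∫ ω : EuclideanSpace ℝ ι, exp (-U (ω + ψ₀)) ∂(multivariateGaussian 0 M⁻¹))⁻¹ • (∫ ω : EuclideanSpace ℝ ι, exp (-U (ω + ψ₀)) • (U'' (ω + ψ₀) -
          (U' (ω + ψ₀)).smulRight (U' (ω + ψ₀))) ∂(multivariateGaussian 0 M⁻¹)) + (((∫ ω : EuclideanSpace ℝ ι, exp (-U (ω + ψ₀)) ∂(multivariateGaussian 0 M⁻¹)) ^ 2)⁻¹ • ∫ ω
          : EuclideanSpace ℝ ι, exp (-U (ω + ψ₀)) • U' (ω + ψ₀) ∂(multivariateGaussian 0 M⁻¹)).smulRight (∫ ω : EuclideanSpace ℝ ι, exp (-U (ω + ψ₀)) • U' (ω + ψ₀)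
          ∂(multivariateGaussian 0 M⁻¹))) (EuclideanSpace.single x (1 : ℝ)) (EuclideanSpace.single y (1 : ℝ)) + ((∫ ω : EuclideanSpace ℝ ι, exp (-U (ω + ψ₀))
          ∂(multivariateGaussian 0 M⁻¹))⁻¹ • (∫ ω : EuclideanSpace ℝ ι, exp (-U (ω + ψ₀)) • (U'' (ω + ψ₀) - (U' (ω + ψ₀)).smulRight (U' (ω + ψ₀))) ∂(multivariateGaussian 0
          M⁻¹)) + (((∫ ω : EuclideanSpace ℝ ι, exp (-U (ω + ψ₀)) ∂(multivariateGaussian 0 M⁻¹)) ^ 2)⁻¹ • ∫ ω : EuclideanSpace ℝ ι, exp (-U (ω + ψ₀)) • U' (ω + ψ₀)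
          ∂(multivariateGaussian 0 M⁻¹)).smulRight (∫ ω : EuclideanSpace ℝ ι, exp (-U (ω + ψ₀)) • U' (ω + ψ₀) ∂(multivariateGaussian 0 M⁻¹))) (EuclideanSpace.single y (1 :
          ℝ)) (EuclideanSpace.single x (1 : ℝ))) / 2) *ᵥ (WithLp.ofLp ζ))) / 2) - (fderiv ℝ (fun φ : EuclideanSpace ℝ ι => -Real.log (∫ ω : EuclideanSpace ℝ ι, exp (-U (ω +
          φ)) ∂(multivariateGaussian 0 M⁻¹))) (ψ₀ + ζ) (ζ' - ζ) - ((WithLp.ofLp ζ) ⬝ᵥ (Matrix.of fun x y : ι => (((∫ ω : EuclideanSpace ℝ ι, exp (-U (ω + ψ₀))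
          ∂(multivariateGaussian 0 M⁻¹))⁻¹ • (∫ ω : EuclideanSpace ℝ ι, exp (-U (ω + ψ₀)) • (U'' (ω + ψ₀) - (U' (ω + ψ₀)).smulRight (U' (ω + ψ₀))) ∂(multivariateGaussian 0
          M⁻¹)) + (((∫ ω : EuclideanSpace ℝ ι, exp (-U (ω + ψ₀)) ∂(multivariateGaussian 0 M⁻¹)) ^ 2)⁻¹ • ∫ ω : EuclideanSpace ℝ ι, exp (-U (ω + ψ₀)) • U' (ω + ψ₀)
          ∂(multivariateGaussian 0 M⁻¹)).smulRight (∫ ω : EuclideanSpace ℝ ι, exp (-U (ω + ψ₀)) • U' (ω + ψ₀) ∂(multivariateGaussian 0 M⁻¹))) (EuclideanSpace.single x (1 :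
          ℝ)) (EuclideanSpace.single y (1 : ℝ)) + ((∫ ω : EuclideanSpace ℝ ι, exp (-U (ω + ψ₀)) ∂(multivariateGaussian 0 M⁻¹))⁻¹ • (∫ ω : EuclideanSpace ℝ ι, exp (-U (ω +
          ψ₀)) • (U'' (ω + ψ₀) - (U' (ω + ψ₀)).smulRight (U' (ω + ψ₀))) ∂(multivariateGaussian 0 M⁻¹)) + (((∫ ω : EuclideanSpace ℝ ι, exp (-U (ω + ψ₀))
          ∂(multivariateGaussian 0 M⁻¹)) ^ 2)⁻¹ • ∫ ω : EuclideanSpace ℝ ι, exp (-U (ω + ψ₀)) • U' (ω + ψ₀) ∂(multivariateGaussian 0 M⁻¹)).smulRight (∫ ω : EuclideanSpace ℝ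
          ι, exp (-U (ω + ψ₀)) • U' (ω + ψ₀) ∂(multivariateGaussian 0 M⁻¹))) (EuclideanSpace.single y (1 : ℝ)) (EuclideanSpace.single x (1 : ℝ))) / 2) *ᵥ (WithLp.ofLp (ζ' -
          ζ)))) ≤ (lam * (∑ i, (ζ' i - ζ i) ^ 2) + Λ / 2 * (∑ x ∈ Y, (ζ' x - ζ x) ^ 2)) := by
  have hU'c : Continuous U' := continuous_iff_continuousAt.2 fun φ => (hU'd φ).continuousAt
  obtain ⟨hup, hlo⟩ := block_neg_log_two_sided_at hM hfl hΓop Y hUd hU'c hκ₀ hκ₁ ha hτ hδ hθ0 hθ1 hκθ hstab hU'b hwup hlam hUsec hm ψ₀ ζ ζ'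
  -- the matrix letters on the increment `ζ′ − ζ`
  obtain ⟨q1, q2⟩ := block_quadratic_part_two_sided hM hfl hΓop Y hUd hU'd hU''c hκ₀ hκ₁ ha hκ₂ hτ hδ hθ0 hθ1 hκθ hstab hU'b hU''b hwup hlam hUsec hm ψ₀ (ζ' - ζ)
  -- symmetry of `K_D` and the quadratic increment
  set L : EuclideanSpace ℝ ι →L[ℝ] EuclideanSpace ℝ ι →L[ℝ] ℝ := ((∫ ω : EuclideanSpace ℝ ι, exp (-U (ω + ψ₀)) ∂(multivariateGaussian 0 M⁻¹))⁻¹ • (∫ ω : EuclideanSpace ℝ ι,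
      exp (-U (ω + ψ₀)) • (U'' (ω + ψ₀) - (U' (ω + ψ₀)).smulRight (U' (ω + ψ₀))) ∂(multivariateGaussian 0 M⁻¹)) + (((∫ ω : EuclideanSpace ℝ ι, exp (-U (ω + ψ₀))
      ∂(multivariateGaussian 0 M⁻¹)) ^ 2)⁻¹ • ∫ ω : EuclideanSpace ℝ ι, exp (-U (ω + ψ₀)) • U' (ω + ψ₀) ∂(multivariateGaussian 0 M⁻¹)).smulRight (∫ ω : EuclideanSpace ℝ ι,
      exp (-U (ω + ψ₀)) • U' (ω + ψ₀) ∂(multivariateGaussian 0 M⁻¹))) with hL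
  have hinc := quadratic_increment
    (symmMatrix_isHermitian (fun x y : ι => L (EuclideanSpace.single x (1 : ℝ)) (EuclideanSpace.single y (1 : ℝ))))
    (WithLp.ofLp ζ) (WithLp.ofLp ζ')
  simp only [WithLp.ofLp_sub, PiLp.sub_apply] at q1 q2 hinc ⊢
  constructor
  · linarith [hup, hlo, q1, q2, hinc]
  · linarith [hup, hlo, q1, q2, hinc]

end Road

/-! ## §4. Toy -/

/-- Toy (§2's arithmetic): `|r| ≤ λS + ΛQ∕2` and `Q ≤ S` give `|r| ≤ (λ + Λ∕2)S` for `Λ ≥ 0`. -/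
example (r lam Λ Q S : ℝ) (hΛ : 0 ≤ Λ) (hQS : Q ≤ S) (h : |r| ≤ lam * S + Λ / 2 * Q) : |r| ≤ (lam + Λ / 2) * S := by
  nlinarith

end Summit.QuantumFields.BalabanUV.T4Continuum.NE7b.SupBlockResidualRegulated
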